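/-
Copyright: cell `pub-ymgap` (HUMAN RULING D-0062), Track A of `YM-PLAN.md`, DAG node N20 (= NE7b); R134 acceleration seat
`pub-ymgap-dag-n20-c` (strategy s1, generation 7), module 38.  Released under the licence of the surrounding project.
-/
import Summits.QuantumFields.YangMills.Theorems.BalabanUVNodesN20LCSLabelTowerAtResidualOfRecordHalves
import HarnessLib

/-!
# YM-DAG node N20 (= NE7b), row s1, module 38: THE SHAPE OF THE WALL — the displayed hypothesis «LCS-j for EVERY plaquette set X and EVERY
# history of the class, in the history term's own state» (modules 30 ∕ 32 ∕ 35 §2–§3) is ONE QUANTIFIER TOO STRONG: at two consecutive pinned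
# levels the class's own terms FORCE its constant, and the forced constant cancels the Peierls gain of the later level

Track A of `YM-PLAN.md` (cell `pub-ymgap`, HUMAN RULING D-0062), node **N20** = spine estimate NE7b (`T4WeightBudget.RelWeightBound`, NOT
PRINTED, NOT PROVED).  Seat `pub-ymgap-dag-n20-c` (R134, s1 «the first missing estimate»), generation 7, module 38 (imports module 35
`…N20LCSLabelTowerAtResidualOfRecordHalves`).  Kernel theorems only: 0 `def`, 0 `sorry`, standard axioms; COUNT-NEUTRAL.  A DIAGNOSTIC
CERTIFICATE about the lineage's OWN display — it asserts nothing of Bałaban's and proves no estimate.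

WHY.  After modules 34–37 the node's first missing estimate stands BY NAME as the hypothesis `hLS` ∕ `hLSpos` of modules 30 ∕ 32 ∕ 35: for
every pinned level `j`, EVERY history `h` of the pattern class at level `j` and EVERY finite set `X` of level-`j` plaquettes,
`∫ e^{a·β_j·Σ_{q∈X}(1 − Re tr U(∂q))}·eterm ρ₀ j h dμ_j ≤ e^{C_j·a·#X}·∫ eterm ρ₀ j h dμ_j` (`0 ≤ a ≤ a₀ j`), with the Peierls rate
`rate j = (m_j·exp(C_j·A_j·cnt·cnt·δ_j − δ_j·β_j·ε″_j²∕(2N)))^{#D_j}` (`A_j = 2N(L²+6((d+2)L)²)² + 2∕α_j`, `cnt = (2((d+3)L+2)+1)^d·d²`).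
THIS FILE shows that the «∀ X, ∀ h» display OVER-ASKS, by the class's own support semantics (module 34) and nothing else:

* §1 **FORCING.**  On the support of the level-`(k+1)` term of a history `h` whose last label's (3.2) family `P` contains the cube `c`, the
  (3.2) factor of `c` VANISHES (`chiFactor_of_eterm_ne_zero_rec`); so if `c` carries the lineage's regularity letter on the region `R` with
  threshold `ε″` («all `p′ ∈ R` have `dist1 (V′(∂p′)) < ε″` ⇒ `chiFactor c V′ = 1`», the [Balaban1985Variational] Thm 1 SHAPE displayed since
  module 18), SOME `p′ ∈ R` — a level-`(k+1)` plaquette — has `ε″ ≤ dist1 (V′(∂p′))` (`exists_le_dist1_of_eterm_ne_zero`), hence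
  `ε″²∕(2N) ≤ Σ_{q∈R}(1 − Re tr V′(∂q))` (`sq_div_le_plaqSum_of_eterm_ne_zero`, n20-d's `sq_div_le_one_sub_reTr_of_le_dist1`), hence POINTWISE
  `e^{aβ·ε″²∕(2N)}·eterm ≤ e^{aβ·Σ_{q∈R}(1 − Re tr V′(∂q))}·eterm` and, integrated, **`exp_mul_integral_eterm_le_integral_exp_plaqSum_mul_eterm`**.
* §2 **THE FORCED CONSTANT.**  If the term has positive mass and «LCS-(k+1)» holds for it at `X := R` with some `a > 0`, then
  **`β·ε″²∕(2N) ≤ C·#R`** (`lcs_const_forced`): the moment constant of the later level is at least the Peierls exponent of the earlier one per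
  plaquette of the regularity region.
* §3 **AT THE DISPLAY** (module 35 §2 ∕ §3's EXACT hypothesis shape, general `ρ₀ ≥ 0`, the residual of record `ζ := zeta316OfRecord A₁`): if
  `i ∈ J` and `i + 1 ∈ J` are both pinned (`i + 1 < K′`, `0 < a₀ (i+1)`), then EVERY history `h` of the pattern class at level `i + 1` has
  `D_i ⊆ P(h(last))` (`subset_labelAt_of_mem_admS`), so every positive-mass such `h` and every `c ∈ D_i` give
  **`β_{i+1}·ε″_i²∕(2N) ≤ C_{i+1}·#R_i(c) ≤ C_{i+1}·m_i`** (`lcs_pinnedLevels_const_forced`, `…_le_mul_m`).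
* §4 **NO GAIN.**  Pure arithmetic: if moreover the thresholds do not grow by the factor `√(A_{i+1}·cnt²∕m_i)` from level `i` to level `i + 1`
  (`ε″_{i+1}²·m_i ≤ ε″_i²·A_{i+1}·cnt·cnt`), the exponent of `rate (i+1)` is nonnegative and **`m_{i+1}^{#D_{i+1}} ≤ rate (i+1)`**
  (`pow_card_le_rate_pinnedLevels`): under the display, the class weight bound of module 35 §2∕§3 carries NO Peierls factor `< 1` at the second
  of two consecutive pinned levels — it is then weaker than the a-priori bound.  (`A·cnt² ≥ 2·(33⁴·16)·N ≈ 3.8·10⁷·N` already at `d = 4`, `L = 2`,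
  while a regularity region is a cube neighbourhood.)

WHAT THIS LOCATES (the repair, NOT typed here).  The forced-large plaquettes of §1 lie in the regularity regions of the PREVIOUS label's large
family `P ⊆ cubes32 k s` (module 34 `chiFactor_of_eterm_ne_zero_rec`), i.e. inside def-T's `Zreg (σ s t) = (Λ_{k+1})ᶜ` and its cube hull
`Ztilde4`, whereas the NEXT step decomposes unity only over `cubes32 (k+1) (σ s t) ⊆ W32 = (Ztilde4)ᶜ` ([Balaban1988Convergent] (3.2) p. 265
«for the domain (Z̃_k^{∼4})ᶜ»), and n20-d's transfer `N20LCSAvgTransfer.localExpMoment_avgFun_of_moments` instantiates the moment hypothesis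
ONLY at `X = Q.biUnion (boxRegion ∘ emb ∘ src)` for `Q` inside the pinned cubes' regularity regions.  The statement of Bałaban's KIND the
(A1c) instance owes is therefore «LCS-j ON THE HULL OF THE (3.2) WINDOW» — `X` ranging over subsets of the box-neighbourhoods of the
regularity regions of cubes of `cubes32 j (seqOfHist j h)` — level-uniformly; the hull-restricted re-display of the chain module 22 → 23 → 30
→ 32 → 35 is mechanical (every proof instantiates `X` inside that hull), and its consistency with §1 is the geometric separation
`Ztilde4 ∩ hull (W32-cubes) = ∅` of def-T's layer algebra under the numeric nesting of `M`, `M₂`, `L` (node00's admissibility) — successor work.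

HONEST FRAMING.  A certificate about the SHAPE of a displayed hypothesis: the multi-level theorems of modules 30∕32∕35 are TRUE as stated;
this file shows their displayed input cannot be met with gainful constants at consecutive pinned levels, and names the repaired display.
NE7b NOT PRINTED ∕ NOT PROVED; (α)-instance 0∕1; N20 NOT discharged; typed 28∕28, discharged count untouched; one finite four-torus at fixed
`ε` — NOT ℝ⁴, NOT infinite volume, NOT OS, NOT a mass gap, NOT Clay.

References (LOCATORS): T. Bałaban, CMP 119 (1988) 243–285 [Balaban1988Convergent] ((3.2)–(3.5) p. 265); CMP 122 (1989) 175–202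
[Balaban1989LargeFieldI] ((0.1) p. 175, (0.3)–(0.5) pp. 176–177); CMP 102 (1985) 277–309 [Balaban1985Variational] (Thm 1 p. 279);
CMP 99 (1985) 75–102 [Balaban1985RegularSpaces] ((1.10) p. 77).
-/

set_option autoImplicit false

noncomputable section

open scoped BigOperators ENNReal

namespace Summit.QuantumFields.YangMills.BalabanUVNodes.N20LCSWallShape

open MeasureTheory
open Literature.MathematicalPhysics.QuantumFieldTheory.Balaban1983to89
open Literature.MathematicalPhysics.QuantumFieldTheory.Balaban1983to89.T4Continuum
open Literature.MathematicalPhysics.QuantumFieldTheory.Balaban1983to89.B14.Eq218Concrete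
open Literature.MathematicalPhysics.QuantumFieldTheory.Balaban1983to89.Node00
open Summit.QuantumFields.BalabanUV.T4Continuum.B16HistoryIndexedRepr (GoodClass)
open Summit.QuantumFields.BalabanUV.T4Continuum.B16HistoryReprChain
open Summit.QuantumFields.BalabanUV.T4Continuum.NE7b.PrefixExtraction (admS mem_admS_succ)
open Summit.QuantumFields.YangMills.BalabanUVNodes.N20LCSLabelTower
open Summit.QuantumFields.YangMills.BalabanUVNodes.N20LCSLabelTowerAtResidualOfRecord (chiFactor_of_eterm_ne_zero_rec)
open Summit.QuantumFields.YangMills.BalabanUVNodes.N20LCSAvgTransfer (measurable_exp_plaqSum_gen abs_exp_plaqSum_gen_le)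
open Summit.QuantumFields.YangMills.BalabanUVNodes.N20LCSAvgExpMoment (sq_div_le_one_sub_reTr_of_le_dist1)

variable (F : T4Family) (N : ℕ) [NeZero N] (ν : Stage7Numerics) (M : ℕ) (p : B12.RunParams) (g : ℕ → ℝ) (A₁ : ℝ)

/-! ## §1 Forcing: on the support of a term whose last label declares `c` large, the regularity region of `c` carries a large plaquette -/

section Forcing

/-- **A LARGE PLAQUETTE IS FORCED.**  If the last label of the history `h` (level `k`) has `c` in its (3.2) large-field family, `c` carries the
regularity letter on the region `R` with threshold `ε″`, and the level-`(k+1)` term of `h` does not vanish at `V′`, then some `p′ ∈ R` has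
`ε″ ≤ dist1 (V′(∂p′))` — module 34's support semantics (`chiFactor c V′ = 0`) and the letter's contrapositive. [folklore] -/
theorem exists_le_dist1_of_eterm_ne_zero (ρ₀ : cfgOfRecord F N p.K 0 → ℝ) (k : ℕ) (h : Fin (k + 1) → LabelPat F ν p g)
    {c : Iχ F ν p g k} (hc : c ∈ (labelAt F ν p g k (h (Fin.last k))).1) (R : Finset (Plaq (F.P p.K) (k + 1))) {ε'' : ℝ}
    (hreg : ∀ V' : GaugeField (F.P p.K) (k + 1) (SU N),
      (∀ p' ∈ R, dist1 (GaugeField.plaqHol V' p') < ε'') → chiFactor F N ν p g k c V' = 1)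
    (V' : cfgOfRecord F N p.K (k + 1))
    (hne : (labelTowerOfRecord F N ν M p g A₁ (zeta316OfRecord F N ν M A₁)).eterm ρ₀ (k + 1) h V' ≠ 0) :
    ∃ p' ∈ R, ε'' ≤ dist1 (GaugeField.plaqHol V' p') := by
  have h0 : chiFactor F N ν p g k c V' = 0 := (chiFactor_of_eterm_ne_zero_rec F N ν M p g A₁ ρ₀ k h V' hne).2.2 c hc
  by_contra hall
  push Not at hall
  have h1 := hreg V' hall
  rw [h0] at h1
  exact zero_ne_one h1

/-- **… HENCE THE REGION'S PLAQUETTE ENERGY IS AT LEAST `ε″²∕(2N)`** on the support of the term (n20-d's `sq_div_le_one_sub_reTr_of_le_dist1`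
at the large plaquette; the other terms are nonnegative). [cite: Balaban1985RegularSpaces, (1.10) p.77] -/
theorem sq_div_le_plaqSum_of_eterm_ne_zero (ρ₀ : cfgOfRecord F N p.K 0 → ℝ) (k : ℕ) (h : Fin (k + 1) → LabelPat F ν p g)
    {c : Iχ F ν p g k} (hc : c ∈ (labelAt F ν p g k (h (Fin.last k))).1) (R : Finset (Plaq (F.P p.K) (k + 1))) {ε'' : ℝ}
    (hε : 0 ≤ ε'')
    (hreg : ∀ V' : GaugeField (F.P p.K) (k + 1) (SU N),
      (∀ p' ∈ R, dist1 (GaugeField.plaqHol V' p') < ε'') → chiFactor F N ν p g k c V' = 1)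
    (V' : cfgOfRecord F N p.K (k + 1))
    (hne : (labelTowerOfRecord F N ν M p g A₁ (zeta316OfRecord F N ν M A₁)).eterm ρ₀ (k + 1) h V' ≠ 0) :
    ε'' ^ 2 / (2 * (Fintype.card (Fin N) : ℝ)) ≤ ∑ q ∈ R, (1 - reTr (GaugeField.plaqHol V' q)) := by
  obtain ⟨p', hp', hle⟩ := exists_le_dist1_of_eterm_ne_zero F N ν M p g A₁ ρ₀ k h hc R hreg V' hne
  calc ε'' ^ 2 / (2 * (Fintype.card (Fin N) : ℝ)) ≤ 1 - reTr (GaugeField.plaqHol V' p') :=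
        sq_div_le_one_sub_reTr_of_le_dist1 _ hε hle
    _ ≤ ∑ q ∈ R, (1 - reTr (GaugeField.plaqHol V' q)) :=
        Finset.single_le_sum (fun q _ => sub_nonneg.2 (GaugeGroup.reTr_le_one (GaugeField.plaqHol V' q))) hp'

/-- **POINTWISE**: `e^{aβ·ε″²∕(2N)}·eterm ≤ e^{aβ·Σ_{q∈R}(1 − Re tr V′(∂q))}·eterm` everywhere (`a, β ≥ 0`, `ρ₀ ≥ 0` good). [folklore] -/
theorem exp_mul_eterm_le_exp_plaqSum_mul_eterm {ρ₀ : cfgOfRecord F N p.K 0 → ℝ} (hρ : (bddMeas (cfgOfRecord F N p.K 0)).Gd ρ₀)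
    (h0 : ∀ U, 0 ≤ ρ₀ U) (k : ℕ) (h : Fin (k + 1) → LabelPat F ν p g)
    {c : Iχ F ν p g k} (hc : c ∈ (labelAt F ν p g k (h (Fin.last k))).1) (R : Finset (Plaq (F.P p.K) (k + 1))) {ε'' : ℝ}
    (hε : 0 ≤ ε'')
    (hreg : ∀ V' : GaugeField (F.P p.K) (k + 1) (SU N),
      (∀ p' ∈ R, dist1 (GaugeField.plaqHol V' p') < ε'') → chiFactor F N ν p g k c V' = 1)
    {a β : ℝ} (ha : 0 ≤ a) (hβ : 0 ≤ β) (V' : cfgOfRecord F N p.K (k + 1)) :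
    Real.exp (a * β * (ε'' ^ 2 / (2 * (Fintype.card (Fin N) : ℝ)))) *
        (labelTowerOfRecord F N ν M p g A₁ (zeta316OfRecord F N ν M A₁)).eterm ρ₀ (k + 1) h V' ≤
      Real.exp (a * β * ∑ q ∈ R, (1 - reTr (GaugeField.plaqHol V' q))) *
        (labelTowerOfRecord F N ν M p g A₁ (zeta316OfRecord F N ν M A₁)).eterm ρ₀ (k + 1) h V' := by
  by_cases hz : (labelTowerOfRecord F N ν M p g A₁ (zeta316OfRecord F N ν M A₁)).eterm ρ₀ (k + 1) h V' = 0
  · simp only [hz, mul_zero, le_refl]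
  · refine mul_le_mul_of_nonneg_right (Real.exp_le_exp.2 (mul_le_mul_of_nonneg_left
      (sq_div_le_plaqSum_of_eterm_ne_zero F N ν M p g A₁ ρ₀ k h hc R hε hreg V' hz) (mul_nonneg ha hβ))) ?_
    exact (labelTowerOfRecord F N ν M p g A₁ (zeta316OfRecord F N ν M A₁)).eterm_nonneg hρ h0 (k + 1) h V'

/-- The carrier-weighted term `e^{t·Σ_{q∈R}(1 − Re tr V′(∂q))}·eterm ρ₀ (k+1) h` is integrable under the level-`(k+1)` law of record
(bounded measurable under a probability measure). [folklore] -/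
theorem integrable_exp_plaqSum_mul_eterm {ρ₀ : cfgOfRecord F N p.K 0 → ℝ} (hρ : (bddMeas (cfgOfRecord F N p.K 0)).Gd ρ₀)
    (k : ℕ) (h : Fin k → LabelPat F ν p g) (t : ℝ) (R : Finset (Plaq (F.P p.K) k)) :
    Integrable (fun V' => Real.exp (t * ∑ q ∈ R, (1 - reTr (GaugeField.plaqHol V' q))) *
        (labelTowerOfRecord F N ν M p g A₁ (zeta316OfRecord F N ν M A₁)).eterm ρ₀ k h V') (lawOfRecord F N p.K k) := by
  refine integrable_of_bddMeas _ ((bddMeas _).mul ?_ ((labelTowerOfRecord F N ν M p g A₁ (zeta316OfRecord F N ν M A₁)).eterm_good hρ k h))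
  exact ⟨measurable_exp_plaqSum_gen t R, Real.exp (|t| * (2 * R.card)), fun V' => abs_exp_plaqSum_gen_le t R V'⟩

/-- ★ **THE FORCED MOMENT, INTEGRATED**: `e^{aβ·ε″²∕(2N)}·∫ eterm ρ₀ (k+1) h dμ_{k+1} ≤ ∫ e^{aβ·Σ_{q∈R}(1 − Re tr V′(∂q))}·eterm ρ₀ (k+1) h dμ_{k+1}`
for every history `h` whose last label declares `c` large, every regularity letter `(R, ε″)` of `c`, every `a, β ≥ 0`. [folklore] -/
theorem exp_mul_integral_eterm_le_integral_exp_plaqSum_mul_eterm {ρ₀ : cfgOfRecord F N p.K 0 → ℝ}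
    (hρ : (bddMeas (cfgOfRecord F N p.K 0)).Gd ρ₀) (h0 : ∀ U, 0 ≤ ρ₀ U) (k : ℕ) (h : Fin (k + 1) → LabelPat F ν p g)
    {c : Iχ F ν p g k} (hc : c ∈ (labelAt F ν p g k (h (Fin.last k))).1) (R : Finset (Plaq (F.P p.K) (k + 1))) {ε'' : ℝ}
    (hε : 0 ≤ ε'')
    (hreg : ∀ V' : GaugeField (F.P p.K) (k + 1) (SU N),
      (∀ p' ∈ R, dist1 (GaugeField.plaqHol V' p') < ε'') → chiFactor F N ν p g k c V' = 1)
    {a β : ℝ} (ha : 0 ≤ a) (hβ : 0 ≤ β) :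
    Real.exp (a * β * (ε'' ^ 2 / (2 * (Fintype.card (Fin N) : ℝ)))) *
        ∫ V', (labelTowerOfRecord F N ν M p g A₁ (zeta316OfRecord F N ν M A₁)).eterm ρ₀ (k + 1) h V' ∂(lawOfRecord F N p.K (k + 1)) ≤
      ∫ V', Real.exp (a * β * ∑ q ∈ R, (1 - reTr (GaugeField.plaqHol V' q))) *
        (labelTowerOfRecord F N ν M p g A₁ (zeta316OfRecord F N ν M A₁)).eterm ρ₀ (k + 1) h V' ∂(lawOfRecord F N p.K (k + 1)) := by
  rw [← integral_const_mul]
  refine integral_mono_of_nonneg (ae_of_all _ fun V' => mul_nonneg (Real.exp_pos _).le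
      ((labelTowerOfRecord F N ν M p g A₁ (zeta316OfRecord F N ν M A₁)).eterm_nonneg hρ h0 (k + 1) h V'))
    (integrable_exp_plaqSum_mul_eterm F N ν M p g A₁ hρ (k + 1) h (a * β) R) (ae_of_all _ fun V' => ?_)
  exact exp_mul_eterm_le_exp_plaqSum_mul_eterm F N ν M p g A₁ hρ h0 k h hc R hε hreg ha hβ V'

end Forcing

/-! ## §2 The forced constant: «LCS-(k+1)» at `X := R` for such a term forces `β·ε″²∕(2N) ≤ C·#R` -/

section ForcedConstant

/-- ★★ **THE FORCED CONSTANT.**  If the level-`(k+1)` term of `h` has positive mass, its last label declares `c` large, `c` carries the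
regularity letter `(R, ε″)`, and «LCS-(k+1)» holds for this term at `X := R` with constant `C` at SOME tilt `a > 0`
(`∫ e^{aβΣ_R}·eterm ≤ e^{C·a·#R}·∫ eterm`), then **`β·ε″²∕(2N) ≤ C·#R`**. [folklore] -/
theorem lcs_const_forced {ρ₀ : cfgOfRecord F N p.K 0 → ℝ} (hρ : (bddMeas (cfgOfRecord F N p.K 0)).Gd ρ₀) (h0 : ∀ U, 0 ≤ ρ₀ U)
    (k : ℕ) (h : Fin (k + 1) → LabelPat F ν p g)
    {c : Iχ F ν p g k} (hc : c ∈ (labelAt F ν p g k (h (Fin.last k))).1) (R : Finset (Plaq (F.P p.K) (k + 1))) {ε'' : ℝ}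
    (hε : 0 ≤ ε'')
    (hreg : ∀ V' : GaugeField (F.P p.K) (k + 1) (SU N),
      (∀ p' ∈ R, dist1 (GaugeField.plaqHol V' p') < ε'') → chiFactor F N ν p g k c V' = 1)
    (hpos : 0 < ∫ V', (labelTowerOfRecord F N ν M p g A₁ (zeta316OfRecord F N ν M A₁)).eterm ρ₀ (k + 1) h V' ∂(lawOfRecord F N p.K (k + 1)))
    {a β C : ℝ} (ha : 0 < a) (hβ : 0 ≤ β)
    (hLS : ∫ V', Real.exp (a * β * ∑ q ∈ R, (1 - reTr (GaugeField.plaqHol V' q))) *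
          (labelTowerOfRecord F N ν M p g A₁ (zeta316OfRecord F N ν M A₁)).eterm ρ₀ (k + 1) h V' ∂(lawOfRecord F N p.K (k + 1)) ≤
        Real.exp (C * a * R.card) *
          ∫ V', (labelTowerOfRecord F N ν M p g A₁ (zeta316OfRecord F N ν M A₁)).eterm ρ₀ (k + 1) h V' ∂(lawOfRecord F N p.K (k + 1))) :
    β * (ε'' ^ 2 / (2 * (Fintype.card (Fin N) : ℝ))) ≤ C * R.card := by
  have h1 := (exp_mul_integral_eterm_le_integral_exp_plaqSum_mul_eterm F N ν M p g A₁ hρ h0 k h hc R hε hreg ha.le hβ).trans hLS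
  have h2 : Real.exp (a * β * (ε'' ^ 2 / (2 * (Fintype.card (Fin N) : ℝ)))) ≤ Real.exp (C * a * R.card) :=
    le_of_mul_le_mul_right h1 hpos
  rw [Real.exp_le_exp] at h2
  have h3 : a * (β * (ε'' ^ 2 / (2 * (Fintype.card (Fin N) : ℝ)))) ≤ a * (C * R.card) := by
    calc a * (β * (ε'' ^ 2 / (2 * (Fintype.card (Fin N) : ℝ)))) = a * β * (ε'' ^ 2 / (2 * (Fintype.card (Fin N) : ℝ))) := by ring
      _ ≤ C * a * R.card := h2
      _ = a * (C * R.card) := by ring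
  exact le_of_mul_le_mul_left h3 ha

end ForcedConstant

/-! ## §3 At the display of modules 32 ∕ 35 §2–§3: two consecutive pinned levels force `β_{i+1}·ε″_i²∕(2N) ≤ C_{i+1}·m_i` -/

section AtTheDisplay

open Classical in
/-- In the pattern class of a label family `E` whose level-`i` members all contain `D_i`, EVERY history at level `i + 1` has `D_i` inside its last
label's (3.2) family (`mem_admS_succ` + the pattern's definition). [folklore] -/
theorem subset_labelAt_of_mem_admS (D : (j : ℕ) → Finset (Iχ F ν p g j))
    (E : (j : ℕ) → (Fin j → LabelPat F ν p g) → Finset (LbOfRecord F ν p g j)) {i : ℕ} (hE : ∀ h t, t ∈ E i h → D i ⊆ t.1)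
    {h : Fin (i + 1) → LabelPat F ν p g}
    (hh : h ∈ admS (labelTowerOfRecord F N ν M p g A₁ (zeta316OfRecord F N ν M A₁)) (labelPattern F ν p g E) (i + 1)) :
    D i ⊆ (labelAt F ν p g i (h (Fin.last i))).1 := by
  obtain ⟨-, -, hlast⟩ := (mem_admS_succ (labelTowerOfRecord F N ν M p g A₁ (zeta316OfRecord F N ν M A₁)) (labelPattern F ν p g E) h).1 hh
  obtain ⟨t, ht, heq⟩ := Finset.mem_map.1 hlast
  have hl : labelAt F ν p g i (h (Fin.last i)) = t := by
    rw [← heq]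
    exact labelAt_mk F ν p g i t
  rw [hl]
  exact hE (Fin.init h) t ht

open Classical in
/-- ★★★ **TWO CONSECUTIVE PINNED LEVELS FORCE THE LATER MOMENT CONSTANT** — at module 35 §2∕§3's EXACT hypothesis shape («LCS-j» for every
history of the class at the pinned levels `j ≥ 1` and EVERY level-`j` plaquette set, `hLSpos`; the regularity letters `hreg` of the pinned cubes;
the pattern `E` pinning `D`): if `i ∈ J` and `i + 1 ∈ J`, `i + 1 < K′`, `0 < a₀ (i+1)`, then for every history `h` of the class at level `i + 1`
whose term has positive mass and every `c ∈ D_i`, **`β (i+1) · ε″_i²∕(2N) ≤ C (i+1) · #R_i(c)`**. [folklore] -/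
theorem lcs_pinnedLevels_const_forced {ρ₀ : cfgOfRecord F N p.K 0 → ℝ} (hρ : (bddMeas (cfgOfRecord F N p.K 0)).Gd ρ₀) (h0 : ∀ U, 0 ≤ ρ₀ U)
    (J : Finset ℕ) (D : (j : ℕ) → Finset (Iχ F ν p g j)) (R : (j : ℕ) → Iχ F ν p g j → Finset (Plaq (F.P p.K) (j + 1))) (ε'' : ℕ → ℝ)
    (hε : ∀ j ∈ J, 0 ≤ ε'' j)
    (hreg : ∀ j ∈ J, ∀ c ∈ D j, ∀ V' : GaugeField (F.P p.K) (j + 1) (SU N),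
      (∀ p' ∈ R j c, dist1 (GaugeField.plaqHol V' p') < ε'' j) → chiFactor F N ν p g j c V' = 1)
    (β C a₀ : ℕ → ℝ) (hβ : ∀ j ∈ J, 0 ≤ β j)
    (K' : ℕ) (E : (j : ℕ) → (Fin j → LabelPat F ν p g) → Finset (LbOfRecord F ν p g j)) (hE : ∀ j ∈ J, ∀ h t, t ∈ E j h → D j ⊆ t.1)
    (hLSpos : ∀ j ∈ J, 1 ≤ j → j < K' → ∀ h : Fin j → LabelPat F ν p g,
      h ∈ admS (labelTowerOfRecord F N ν M p g A₁ (zeta316OfRecord F N ν M A₁)) (labelPattern F ν p g E) j →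
      ∀ a : ℝ, 0 ≤ a → a ≤ a₀ j → ∀ X : Finset (Plaq (F.P p.K) j),
        ∫ U, Real.exp (a * β j * ∑ q ∈ X, (1 - reTr (GaugeField.plaqHol U q))) *
            (labelTowerOfRecord F N ν M p g A₁ (zeta316OfRecord F N ν M A₁)).eterm ρ₀ j h U ∂(lawOfRecord F N p.K j) ≤
          Real.exp (C j * a * X.card) * ∫ U, (labelTowerOfRecord F N ν M p g A₁ (zeta316OfRecord F N ν M A₁)).eterm ρ₀ j h U ∂(lawOfRecord F N p.K j))
    {i : ℕ} (hi : i ∈ J) (hi1 : i + 1 ∈ J) (hiK : i + 1 < K') (ha₀ : 0 < a₀ (i + 1))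
    {h : Fin (i + 1) → LabelPat F ν p g}
    (hh : h ∈ admS (labelTowerOfRecord F N ν M p g A₁ (zeta316OfRecord F N ν M A₁)) (labelPattern F ν p g E) (i + 1))
    (hpos : 0 < ∫ V', (labelTowerOfRecord F N ν M p g A₁ (zeta316OfRecord F N ν M A₁)).eterm ρ₀ (i + 1) h V' ∂(lawOfRecord F N p.K (i + 1)))
    {c : Iχ F ν p g i} (hc : c ∈ D i) :
    β (i + 1) * (ε'' i ^ 2 / (2 * (Fintype.card (Fin N) : ℝ))) ≤ C (i + 1) * (R i c).card := by
  have hcP : c ∈ (labelAt F ν p g i (h (Fin.last i))).1 := subset_labelAt_of_mem_admS F N ν M p g A₁ D E (hE i hi) hh hc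
  exact lcs_const_forced F N ν M p g A₁ hρ h0 i h hcP (R i c) (hε i hi) (hreg i hi c hc) hpos ha₀ (hβ (i + 1) hi1)
    (hLSpos (i + 1) hi1 (Nat.succ_le_succ (Nat.zero_le i)) hiK h hh (a₀ (i + 1)) ha₀.le le_rfl (R i c))

open Classical in
/-- **… in the size letter `m_i`**: with `#R_i(c) ≤ m_i` and `0 ≤ C (i+1)`, `β (i+1) · ε″_i²∕(2N) ≤ C (i+1) · m_i`. [folklore] -/
theorem lcs_pinnedLevels_const_forced_le_mul_m {ρ₀ : cfgOfRecord F N p.K 0 → ℝ} (hρ : (bddMeas (cfgOfRecord F N p.K 0)).Gd ρ₀)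
    (h0 : ∀ U, 0 ≤ ρ₀ U)
    (J : Finset ℕ) (D : (j : ℕ) → Finset (Iχ F ν p g j)) (R : (j : ℕ) → Iχ F ν p g j → Finset (Plaq (F.P p.K) (j + 1))) (m : ℕ → ℕ)
    (ε'' : ℕ → ℝ) (hε : ∀ j ∈ J, 0 ≤ ε'' j) (hm : ∀ j ∈ J, ∀ c ∈ D j, (R j c).card ≤ m j)
    (hreg : ∀ j ∈ J, ∀ c ∈ D j, ∀ V' : GaugeField (F.P p.K) (j + 1) (SU N),
      (∀ p' ∈ R j c, dist1 (GaugeField.plaqHol V' p') < ε'' j) → chiFactor F N ν p g j c V' = 1)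
    (β C a₀ : ℕ → ℝ) (hβ : ∀ j ∈ J, 0 ≤ β j) (hC : ∀ j ∈ J, 0 ≤ C j)
    (K' : ℕ) (E : (j : ℕ) → (Fin j → LabelPat F ν p g) → Finset (LbOfRecord F ν p g j)) (hE : ∀ j ∈ J, ∀ h t, t ∈ E j h → D j ⊆ t.1)
    (hLSpos : ∀ j ∈ J, 1 ≤ j → j < K' → ∀ h : Fin j → LabelPat F ν p g,
      h ∈ admS (labelTowerOfRecord F N ν M p g A₁ (zeta316OfRecord F N ν M A₁)) (labelPattern F ν p g E) j →
      ∀ a : ℝ, 0 ≤ a → a ≤ a₀ j → ∀ X : Finset (Plaq (F.P p.K) j),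
        ∫ U, Real.exp (a * β j * ∑ q ∈ X, (1 - reTr (GaugeField.plaqHol U q))) *
            (labelTowerOfRecord F N ν M p g A₁ (zeta316OfRecord F N ν M A₁)).eterm ρ₀ j h U ∂(lawOfRecord F N p.K j) ≤
          Real.exp (C j * a * X.card) * ∫ U, (labelTowerOfRecord F N ν M p g A₁ (zeta316OfRecord F N ν M A₁)).eterm ρ₀ j h U ∂(lawOfRecord F N p.K j))
    {i : ℕ} (hi : i ∈ J) (hi1 : i + 1 ∈ J) (hiK : i + 1 < K') (ha₀ : 0 < a₀ (i + 1))
    {h : Fin (i + 1) → LabelPat F ν p g}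
    (hh : h ∈ admS (labelTowerOfRecord F N ν M p g A₁ (zeta316OfRecord F N ν M A₁)) (labelPattern F ν p g E) (i + 1))
    (hpos : 0 < ∫ V', (labelTowerOfRecord F N ν M p g A₁ (zeta316OfRecord F N ν M A₁)).eterm ρ₀ (i + 1) h V' ∂(lawOfRecord F N p.K (i + 1)))
    {c : Iχ F ν p g i} (hc : c ∈ D i) :
    β (i + 1) * (ε'' i ^ 2 / (2 * (Fintype.card (Fin N) : ℝ))) ≤ C (i + 1) * m i :=
  (lcs_pinnedLevels_const_forced F N ν M p g A₁ hρ h0 J D R ε'' hε hreg β C a₀ hβ K' E hE hLSpos hi hi1 hiK ha₀ hh hpos hc).trans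
    (mul_le_mul_of_nonneg_left (by exact_mod_cast hm i hi c hc) (hC (i + 1) hi1))

end AtTheDisplay

/-! ## §4 No gain: the forced constant makes the later level's rate at least `m^{#D} ≥ 1` unless the thresholds grow by `√(A·cnt²∕m)` -/

section NoGain

/-- Arithmetic: a forced constant `β·ε₀²∕(2N) ≤ C·m₀` (`m₀ > 0`) and thresholds that do not grow by the factor `√(G∕m₀)` (`ε₁²·m₀ ≤ ε₀²·G`,
`G ≥ 0`) give `β·ε₁²∕(2N) ≤ C·G`. [folklore] -/
theorem mul_sq_div_le_of_forced {β C ε₀ ε₁ G Ncard : ℝ} {m₀ : ℕ} (hN : 0 < Ncard) (hβ : 0 ≤ β) (hm₀ : 0 < m₀)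
    (hforced : β * (ε₀ ^ 2 / (2 * Ncard)) ≤ C * m₀) (hthr : ε₁ ^ 2 * m₀ ≤ ε₀ ^ 2 * G) (hG : 0 ≤ G) :
    β * (ε₁ ^ 2 / (2 * Ncard)) ≤ C * G := by
  have hm : (0 : ℝ) < (m₀ : ℝ) := by exact_mod_cast hm₀
  have h2N : 0 < 2 * Ncard := by linarith
  have key : β * (ε₁ ^ 2 / (2 * Ncard)) * m₀ ≤ C * G * m₀ := by
    calc β * (ε₁ ^ 2 / (2 * Ncard)) * m₀ = β / (2 * Ncard) * (ε₁ ^ 2 * m₀) := by ring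
      _ ≤ β / (2 * Ncard) * (ε₀ ^ 2 * G) := mul_le_mul_of_nonneg_left hthr (div_nonneg hβ h2N.le)
      _ = β * (ε₀ ^ 2 / (2 * Ncard)) * G := by ring
      _ ≤ C * m₀ * G := mul_le_mul_of_nonneg_right hforced hG
      _ = C * G * m₀ := by ring
  exact le_of_mul_le_mul_right key hm

/-- Arithmetic: if the Peierls exponent of a level is dominated by its forced moment cost (`β·ε₁²∕(2N) ≤ C·((A·cnt)·cnt)`, `δ ≥ 0`), the level's
rate `(m₁·exp(C·(A·cnt)·cnt·δ − δ·β·ε₁²∕(2N)))^n` is at least `m₁^n`. [folklore] -/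
theorem pow_le_rate_of_exponent_nonneg {β C ε₁ A cnt δ Ncard : ℝ} (m₁ n : ℕ) (hδ : 0 ≤ δ)
    (hdom : β * (ε₁ ^ 2 / (2 * Ncard)) ≤ C * ((A * cnt) * cnt)) :
    ((m₁ : ℝ)) ^ n ≤ ((m₁ : ℝ) * Real.exp (C * (A * cnt) * cnt * δ - δ * β * (ε₁ ^ 2 / (2 * Ncard)))) ^ n := by
  refine pow_le_pow_left₀ (Nat.cast_nonneg _) (le_mul_of_one_le_right (Nat.cast_nonneg _) (Real.one_le_exp ?_)) n
  have : δ * β * (ε₁ ^ 2 / (2 * Ncard)) ≤ C * (A * cnt) * cnt * δ := by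
    calc δ * β * (ε₁ ^ 2 / (2 * Ncard)) = δ * (β * (ε₁ ^ 2 / (2 * Ncard))) := by ring
      _ ≤ δ * (C * ((A * cnt) * cnt)) := mul_le_mul_of_nonneg_left hdom hδ
      _ = C * (A * cnt) * cnt * δ := by ring
  linarith

open Classical in
/-- ★★★ **NO PEIERLS GAIN AT THE SECOND OF TWO CONSECUTIVE PINNED LEVELS UNDER THE DISPLAY.**  In module 35 §2∕§3's hypothesis list (rates `hrate`,
letters `hreg`, `hm`, the pattern `hE`, «LCS-j» as displayed `hLSpos`), let `i, i+1 ∈ J` (`i + 1 < K′`, `0 < a₀ (i+1)`, `0 < m_i`), let the thresholds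
not grow by the factor `√(A_{i+1}·cnt²∕m_i)` (`ε″_{i+1}²·m_i ≤ ε″_i²·A_{i+1}·cnt·cnt`), and let SOME history of the class at level `i + 1` have a term
of positive mass with `D_i` non-empty.  Then **`m_{i+1}^{#D_{i+1}} ≤ rate (i+1)`** — the level-`(i+1)` factor of module 35's `Π_j rate j` is `≥ 1`
whenever `m_{i+1} ≥ 1`: the displayed «∀ X, ∀ h» input cannot be met with a gainful constant there. [folklore] -/
theorem pow_card_le_rate_pinnedLevels {ρ₀ : cfgOfRecord F N p.K 0 → ℝ} (hρ : (bddMeas (cfgOfRecord F N p.K 0)).Gd ρ₀) (h0 : ∀ U, 0 ≤ ρ₀ U)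
    (J : Finset ℕ) (D : (j : ℕ) → Finset (Iχ F ν p g j)) (R : (j : ℕ) → Iχ F ν p g j → Finset (Plaq (F.P p.K) (j + 1))) (m : ℕ → ℕ)
    (ε'' : ℕ → ℝ) (hε : ∀ j ∈ J, 0 ≤ ε'' j) (hm : ∀ j ∈ J, ∀ c ∈ D j, (R j c).card ≤ m j)
    (hreg : ∀ j ∈ J, ∀ c ∈ D j, ∀ V' : GaugeField (F.P p.K) (j + 1) (SU N),
      (∀ p' ∈ R j c, dist1 (GaugeField.plaqHol V' p') < ε'' j) → chiFactor F N ν p g j c V' = 1)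
    (α β C a₀ δ rate : ℕ → ℝ) (hα : ∀ j ∈ J, 0 < α j) (hβ : ∀ j ∈ J, 0 ≤ β j) (hC : ∀ j ∈ J, 0 ≤ C j) (hδ0 : ∀ j ∈ J, 0 ≤ δ j)
    (hrate : ∀ j ∈ J, rate j = ((m j : ℝ) * Real.exp (C j * ((2 * (Fintype.card (Fin N) : ℝ) *
            (((F.P p.K).L : ℝ) ^ 2 + 6 * ((((F.P p.K).d + 2) * (F.P p.K).L : ℕ) : ℝ) ^ 2) ^ 2 + 2 / α j) *
          (((2 * (((F.P p.K).d + 3) * (F.P p.K).L + 2) + 1) ^ (F.P p.K).d * (F.P p.K).d ^ 2 : ℕ) : ℝ)) *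
          (((2 * (((F.P p.K).d + 3) * (F.P p.K).L + 2) + 1) ^ (F.P p.K).d * (F.P p.K).d ^ 2 : ℕ) : ℝ) * δ j -
            δ j * β j * (ε'' j ^ 2 / (2 * (Fintype.card (Fin N) : ℝ))))) ^ (D j).card)
    (K' : ℕ) (E : (j : ℕ) → (Fin j → LabelPat F ν p g) → Finset (LbOfRecord F ν p g j)) (hE : ∀ j ∈ J, ∀ h t, t ∈ E j h → D j ⊆ t.1)
    (hLSpos : ∀ j ∈ J, 1 ≤ j → j < K' → ∀ h : Fin j → LabelPat F ν p g,
      h ∈ admS (labelTowerOfRecord F N ν M p g A₁ (zeta316OfRecord F N ν M A₁)) (labelPattern F ν p g E) j →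
      ∀ a : ℝ, 0 ≤ a → a ≤ a₀ j → ∀ X : Finset (Plaq (F.P p.K) j),
        ∫ U, Real.exp (a * β j * ∑ q ∈ X, (1 - reTr (GaugeField.plaqHol U q))) *
            (labelTowerOfRecord F N ν M p g A₁ (zeta316OfRecord F N ν M A₁)).eterm ρ₀ j h U ∂(lawOfRecord F N p.K j) ≤
          Real.exp (C j * a * X.card) * ∫ U, (labelTowerOfRecord F N ν M p g A₁ (zeta316OfRecord F N ν M A₁)).eterm ρ₀ j h U ∂(lawOfRecord F N p.K j))
    {i : ℕ} (hi : i ∈ J) (hi1 : i + 1 ∈ J) (hiK : i + 1 < K') (ha₀ : 0 < a₀ (i + 1)) (hmi : 0 < m i)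
    (hthr : ε'' (i + 1) ^ 2 * m i ≤ ε'' i ^ 2 *
      (((2 * (Fintype.card (Fin N) : ℝ) * (((F.P p.K).L : ℝ) ^ 2 + 6 * ((((F.P p.K).d + 2) * (F.P p.K).L : ℕ) : ℝ) ^ 2) ^ 2 + 2 / α (i + 1)) *
          (((2 * (((F.P p.K).d + 3) * (F.P p.K).L + 2) + 1) ^ (F.P p.K).d * (F.P p.K).d ^ 2 : ℕ) : ℝ)) *
        (((2 * (((F.P p.K).d + 3) * (F.P p.K).L + 2) + 1) ^ (F.P p.K).d * (F.P p.K).d ^ 2 : ℕ) : ℝ)))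
    {h : Fin (i + 1) → LabelPat F ν p g}
    (hh : h ∈ admS (labelTowerOfRecord F N ν M p g A₁ (zeta316OfRecord F N ν M A₁)) (labelPattern F ν p g E) (i + 1))
    (hpos : 0 < ∫ V', (labelTowerOfRecord F N ν M p g A₁ (zeta316OfRecord F N ν M A₁)).eterm ρ₀ (i + 1) h V' ∂(lawOfRecord F N p.K (i + 1)))
    {c : Iχ F ν p g i} (hc : c ∈ D i) :
    ((m (i + 1) : ℝ)) ^ (D (i + 1)).card ≤ rate (i + 1) := by
  have hforced := lcs_pinnedLevels_const_forced_le_mul_m F N ν M p g A₁ hρ h0 J D R m ε'' hε hm hreg β C a₀ hβ hC K' E hE hLSpos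
    hi hi1 hiK ha₀ hh hpos hc
  have hN : (0 : ℝ) < (Fintype.card (Fin N) : ℝ) := by exact_mod_cast Fintype.card_pos
  have hApos : 0 ≤ ((2 * (Fintype.card (Fin N) : ℝ) * (((F.P p.K).L : ℝ) ^ 2 + 6 * ((((F.P p.K).d + 2) * (F.P p.K).L : ℕ) : ℝ) ^ 2) ^ 2 +
        2 / α (i + 1)) * (((2 * (((F.P p.K).d + 3) * (F.P p.K).L + 2) + 1) ^ (F.P p.K).d * (F.P p.K).d ^ 2 : ℕ) : ℝ)) *
      (((2 * (((F.P p.K).d + 3) * (F.P p.K).L + 2) + 1) ^ (F.P p.K).d * (F.P p.K).d ^ 2 : ℕ) : ℝ) := by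
    have := hα (i + 1) hi1
    positivity
  have hdom := mul_sq_div_le_of_forced hN (hβ (i + 1) hi1) hmi hforced hthr hApos
  rw [hrate (i + 1) hi1]
  exact pow_le_rate_of_exponent_nonneg (m (i + 1)) (D (i + 1)).card (hδ0 (i + 1) hi1) hdom

end NoGain

end Summit.QuantumFields.YangMills.BalabanUVNodes.N20LCSWallShape

end
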